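import Summits.ResolutionOfSingularities.ResolutionOfSingularities.Theorems.WildConesClassicalRegimesDefs
import Summits.ResolutionOfSingularities.ResolutionOfSingularities.Theorems.JacobianBudgetIsolatedJacobianDropBaseChangeAux

/-!
# Route `JacobianBudget`, crux `IsolatedJacobianDrop` (stmt-ResolutionOfSingularities-18946), line
# `euler-noether`: stub `stub_baseChange` (S1) — the dynamics and its invariants under extension of
# the ground field

For the point-blow-up dynamics of the height-one atom `z ^ p = a(u₁, …, uₙ)` named in
`Theorems/WildConesClassicalRegimesDefs.lean` (`clean`, `bl`, `ord`, `dv`, `tr`, `step`, `ser`, `pd`,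
`jac`, `Isol`, `MultP`, `mu`) and a field extension `κ → L` (any `Algebra κ L` between fields,
`φ = algebraMap κ L`, a state `c` extended coefficientwise to `c_L = φ ∘ c`, a translation `τ` to
`τ_L = φ ∘ τ`), we prove the registered stub `stub_baseChange` of line `euler-noether` BY NAME with
its registered signature:

  `(Isol p n κ c ↔ Isol p n L c_L) ∧ (MultP p n κ c ↔ MultP p n L c_L) ∧ mu p n κ c = mu p n L c_L ∧`
  `φ ∘ step p n κ i τ c = step p n L i τ_L c_L`.

The COLENGTH half — an ideal `J` of `κ⟦x⟧` and its extension `J_L = J.map ψ` along the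
coefficientwise map `ψ = MvPowerSeries.map φ` have `κ⟦x⟧/J` finite iff `L⟦x⟧/J_L` finite, of the
same dimension — is the landed kit `Theorems/JacobianBudgetIsolatedJacobianDropBaseChangeAux.lean`
(`BaseChange.finite_iff`, `BaseChange.finrank_eq`). This file adds the CALCULUS half
(namespace `BaseChangeCalc`, for any ring homomorphism `φ` between fields): `clean`, `bl`, `dv`, `tr`,
`step` commute with `φ` (they are polynomial in the coefficients with integer structure constants:
`map_sum`, `map_prod`, `map_natCast`), `ord` and `MultP` are invariant (they only see the support,
and `φ` is injective), `ser ∘ (φ ∘ ·) = ψ ∘ ser`, `pd ∘ ψ = ψ ∘ pd`, hence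
`jac p n L c_L = (jac p n κ c).map ψ` — the Jacobian ideal of the extended state IS the extended
Jacobian ideal, which is what the colength kit consumes.

Imports: `WildConesClassicalRegimesDefs` (the named calculus) and the Aux kit; the stub is stated
with its registered signature verbatim over the named calculus (as `stub_eulerTransform`,
`stub_polarAdditivity` were), so `Theorems/JacobianBudgetDefs.lean` is not imported. BANK item of
chain W4.1 (campaign res-hironaka, rung L, slot W4.1), explicitly not summit progress. Everything here
is OURS and elementary; it replaces the role of no printed item and is NOT a statement of Hironaka's
manuscript. [folklore]
-/

noncomputable section

-- single-problem summit: the doubled namespace component `ResolutionOfSingularities` is forced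
set_option linter.dupNamespace false

open scoped BigOperators Classical

open Summit.ResolutionOfSingularities.ResolutionOfSingularities.Theorems.WildCones
  (clean bl ord dv tr step run ser pd jac Isol MultP mu)

namespace Summit.ResolutionOfSingularities.ResolutionOfSingularities.Theorems.JacobianBudget

namespace BaseChangeCalc

variable {p n : ℕ} {κ L : Type} [Field κ] [Field L] (φ : κ →+* L)

/-! ## The coefficient calculus commutes with a homomorphism of fields -/

/-- Cleaning commutes with `φ`: `clean (φ ∘ c) = φ ∘ clean c`. [folklore] -/
theorem clean_comp (c : (Fin n → ℕ) → κ) :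
    clean p n L (fun A => φ (c A)) = fun A => φ (clean p n κ c A) := by
  funext A
  simp only [clean]
  split_ifs <;> simp

/-- The order only sees the support, which `φ` (injective) preserves: `ord (φ ∘ g) = ord g`.
[folklore] -/
theorem ord_comp (g : (Fin n → ℕ) → κ) : ord n L (fun A => φ (g A)) = ord n κ g := by
  simp only [ord, map_ne_zero_iff φ φ.injective]

/-- The blow-up chart map commutes with `φ`: `bl i (φ ∘ g) = φ ∘ bl i g`. [folklore] -/
theorem bl_comp (i : Fin n) (g : (Fin n → ℕ) → κ) :
    bl n L i (fun A => φ (g A)) = fun B => φ (bl n κ i g B) := by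
  funext B
  simp only [bl]
  split_ifs <;> simp

/-- Division by `u_i ^ s` commutes with `φ` (a re-indexing). [folklore] -/
theorem dv_comp (i : Fin n) (s : ℕ) (g : (Fin n → ℕ) → κ) :
    dv n L i s (fun A => φ (g A)) = fun B => φ (dv n κ i s g B) := rfl

/-- The translation commutes with `φ`: `tr i (φ ∘ τ) s (φ ∘ g) = φ ∘ tr i τ s g` (a finite sum of
products with binomial-coefficient structure constants). [folklore] -/
theorem tr_comp (i : Fin n) (τ : Fin n → κ) (s : ℕ) (g : (Fin n → ℕ) → κ) :
    tr n L i (fun j => φ (τ j)) s (fun A => φ (g A)) = fun B => φ (tr n κ i τ s g B) := by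
  funext B
  simp only [tr, map_sum]
  refine Finset.sum_congr rfl fun D _ => ?_
  split_ifs
  · simp [map_mul, map_prod, map_pow, map_natCast]
  · simp

/-- **One step of the dynamics commutes with `φ`**: `step i (φ ∘ τ) (φ ∘ c) = φ ∘ step i τ c`
(the dividing exponent agrees because the cleaned orders agree, `ord_comp`). [folklore] -/
theorem step_comp (i : Fin n) (τ : Fin n → κ) (c : (Fin n → ℕ) → κ) :
    step p n L i (fun j => φ (τ j)) (fun A => φ (c A)) = fun A => φ (step p n κ i τ c A) := by
  simp only [step]
  rw [clean_comp φ c, ord_comp φ, bl_comp φ, dv_comp φ, tr_comp φ, clean_comp φ]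

/-- **Multiplicity `p` is invariant**: `MultP (φ ∘ c) ↔ MultP c` (cleaning commutes with `φ` and
`φ` is injective). [folklore] -/
theorem multP_iff (c : (Fin n → ℕ) → κ) :
    MultP p n κ c ↔ MultP p n L (fun A => φ (c A)) := by
  simp only [MultP, clean_comp φ c, map_ne_zero_iff φ φ.injective]

/-! ## The series, the partials and the Jacobian ideal under `ψ = MvPowerSeries.map φ` -/

/-- The series of the extended state is the coefficientwise image of the series:
`ser (φ ∘ c) = ψ (ser c)`. [folklore] -/
theorem ser_comp (c : (Fin n → ℕ) → κ) :
    ser p n L (fun A => φ (c A)) = MvPowerSeries.map φ (ser p n κ c) := by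
  ext e
  rw [MvPowerSeries.coeff_map, MvPowerSeries.coeff_apply, MvPowerSeries.coeff_apply]
  show clean p n L (fun A => φ (c A)) ⇑e = φ (clean p n κ c ⇑e)
  rw [clean_comp φ c]

/-- The hand-rolled partial derivative commutes with `ψ`: `pd i (ψ f) = ψ (pd i f)` (integer
structure constants `A_i + 1`). [folklore] -/
theorem pd_map (i : Fin n) (f : MvPowerSeries (Fin n) κ) :
    pd n L i (MvPowerSeries.map φ f) = MvPowerSeries.map φ (pd n κ i f) := by
  ext e
  rw [MvPowerSeries.coeff_map, MvPowerSeries.coeff_apply, MvPowerSeries.coeff_apply]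
  show ((e i + 1 : ℕ) : L) * (MvPowerSeries.map φ f) (e + Finsupp.single i 1) =
    φ (((e i + 1 : ℕ) : κ) * f (e + Finsupp.single i 1))
  rw [map_mul, map_natCast, ← MvPowerSeries.coeff_apply (MvPowerSeries.map φ f),
    MvPowerSeries.coeff_map, MvPowerSeries.coeff_apply]

/-- **The Jacobian ideal of the extended state is the extended Jacobian ideal**:
`jac (φ ∘ c) = (jac c).map ψ`. [folklore] -/
theorem jac_comp (c : (Fin n → ℕ) → κ) :
    jac p n L (fun A => φ (c A)) = (jac p n κ c).map (MvPowerSeries.map φ) := by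
  have h : (fun i => pd n L i (ser p n L (fun A => φ (c A)))) =
      (MvPowerSeries.map φ) ∘ (fun i => pd n κ i (ser p n κ c)) := by
    funext i
    simp only [Function.comp_apply]
    rw [ser_comp, pd_map]
  simp only [jac]
  rw [h, Set.range_comp, Ideal.map_span]

end BaseChangeCalc

/-! ## The registered stub, by name and signature -/

/-- **Stub S1 `stub_baseChange` of line `euler-noether`** (crux `IsolatedJacobianDrop`,
stmt-ResolutionOfSingularities-18946; registered name and signature): for every `p`, `n`, every
extension of fields `κ → L` and every state `c`, chart `i`, translation `τ`, the predicates `Isol`,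
`MultP` and the colength `mu` are invariant under coefficientwise extension of the ground field, and
`step` commutes with it. Colength half: `BaseChange.finite_iff` / `BaseChange.finrank_eq` (the Aux
kit) applied to `BaseChangeCalc.jac_comp`; calculus half: `BaseChangeCalc.multP_iff`,
`BaseChangeCalc.step_comp`. [folklore] -/
theorem stub_baseChange :
    ∀ (p n : ℕ) (κ L : Type) [Field κ] [Field L] [Algebra κ L]
      (c : (Fin n → ℕ) → κ) (i : Fin n) (τ : Fin n → κ),
      (Isol p n κ c ↔ Isol p n L (fun A => algebraMap κ L (c A))) ∧
      (MultP p n κ c ↔ MultP p n L (fun A => algebraMap κ L (c A))) ∧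
      mu p n κ c = mu p n L (fun A => algebraMap κ L (c A)) ∧
      (fun A => algebraMap κ L (step p n κ i τ c A)) =
        step p n L i (fun j => algebraMap κ L (τ j)) (fun A => algebraMap κ L (c A)) := by
  intro p n κ L _ _ _ c i τ
  have hj := BaseChangeCalc.jac_comp (p := p) (algebraMap κ L) c
  exact ⟨BaseChange.finite_iff hj, BaseChangeCalc.multP_iff (algebraMap κ L) c,
    BaseChange.finrank_eq hj, (BaseChangeCalc.step_comp (algebraMap κ L) i τ c).symm⟩

end Summit.ResolutionOfSingularities.ResolutionOfSingularities.Theorems.JacobianBudget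

end
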